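import Mathlib
import Literature.NumberTheory.Sieve.Maynard2016Growth
import HarnessLib

/-!
# Maynard 2016, Lemma 7: the positivity step (6.22)

Topic `Literature/NumberTheory/Sieve`. J. Maynard, *Large gaps between primes*, Ann. of Math. (2)
183 (2016), 915–933 = arXiv:1408.5110, §6, proof of Lemma 7, display (6.22): "Since all terms are
non-negative, we obtain a lower bound by dropping all terms in the sum over `n` except for when
`n = p₀ − hq` for some `h ∈ 𝓗`. We see that `(p₀ + (h_i − h)q, P_w) = (p₀, P_w) = 1` and
`(mp₀ + m(h_i − h)q − 1, P_w) = (mp₀ − 1, P_w) = 1` so all the terms `n = p₀ − hq` appear in the sum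
(since, by assumption, `h_k x < p₀ < U/m − h_k x`)."

PROVED here: `sum_divSum_sq_le_classSum` (the terms `n_i = p₀ − h_i q`, `i < k`, are distinct
members of the class `p₀ (mod q)` of the W-tricked range, so
`Σ_i (Σ_{d,e} λ)²(n_i) ≤ classSum(p₀ mod q)`), and the reduction
`lemma7Main_of_pos : Lemma7Pos → Lemma7Main`, where `Lemma7Pos` is `Lemma7Main` with the class sum
replaced by `Σ_i (divisor sum at n_i)²` — i.e. the right-hand side of (6.22) normalised by the main
term `M_{m,q}` of Lemma 6. Consequences: `lemma7_of_lemma6_pos`, `theorem1_of_lemma6_pos :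
Lemma6 → Lemma7Pos → Maynard2016_theorem1`, `forall_rankinConstant_of_lemma6_pos`.

`Lemma7Pos` is a NAMED FACT (`def … : Prop`): displays (6.23)–(6.31) of the source (residue classes
modulo `P_w`, the bound for `𝔖_{m,q}⁻¹`, Bombieri–Vinogradov, evaluation of the complete sums).

## References

* J. Maynard, *Large gaps between primes*, Ann. of Math. (2) 183 (2016), 915–933; arXiv:1408.5110,
  Lemma 7 (proof, displays (6.21)–(6.31)). [Maynard2016LargeGaps]
-/

open Filter Finset
open scoped Topology

namespace Literature.NumberTheory.Sieve

namespace Maynard2016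

/-! ### The named fact: (6.22) normalised -/

/-- **Maynard 2016, proof of Lemma 7 from display (6.22) on** (named fact): with the quantifiers of
`Lemma7`/`Lemma7Main`,
`Σ_{q ∈ 𝓘_m prime} (Σ_{i} (Σ_{d_j | p₀+(h_j−h_i)q} Σ_{e_j | m(p₀+(h_j−h_i)q)−1} λ_{d,e})²) / M_{m,q}
  ≥ (1 − κ) c (B − A)(Σ_i J_k^{(1),i}(F)) J_k^{(2)}(G) / ((log x)|𝓡_m| I_k^{(1)}(F) I_k^{(2)}(G))`,
the inner terms being the divisor sums of (4.1) at `n = p₀ − h_i q`. Not proved here (displays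
(6.23)–(6.31): classes mod `P_w`, the bound for `𝔖_{m,q}⁻¹`, Bombieri–Vinogradov for the primes
`q ∈ 𝓘_m`, evaluation of the complete sums). [cite: Maynard2016LargeGaps, Lemma 7 (proof, displays (6.22)–(6.31))] -/
def Lemma7Pos : Prop :=
  ∀ C_U : ℝ, 0 < C_U → ∀ᶠ ε : ℝ in 𝓝[>] 0, ∃ c : ℝ, 0 < c ∧ ∀ k : ℕ, 2 ≤ k →
    ∀ (J : ℕ) (cj : Fin J → ℝ) (Fd : Fin k → Fin J → ℝ → ℝ) (G : ℝ → ℝ),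
      IsSieveData k J cj Fd G → 0 < I1 cj Fd → 0 < I2 k G → ∀ δ : ℝ, 0 < δ → ∀ κ : ℝ, 0 < κ →
        ∀ᶠ x : ℕ in atTop,
          ∀ m : ℕ, 1 ≤ m → Even m → (m : ℝ) < U C_U ε x / (z x * (Real.log (Real.log x)) ^ 2) →
            ∀ A B : ℝ, (x : ℝ) / 2 ≤ A → B ≤ x →
              δ * (Rm C_U ε x m).card * Real.log x ≤ B - A →
                ∀ p₀ ∈ Rm C_U ε x m,
                  (∀ i : Fin k, (hTuple k x i : ℝ) * x < p₀ ∧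
                      (p₀ : ℝ) < U C_U ε x / m - hTuple k x i * x) →
                    (1 - κ) * c * ((B - A) * (∑ i, J1 cj Fd i) * J2 k G) /
                        (Real.log x * (Rm C_U ε x m).card * I1 cj Fd * I2 k G) ≤
                      ∑ q ∈ intervalPrimes A B,
                        (∑ i : Fin k, divSum cj Fd G ε x m q (p₀ - hTuple k x i * q) ^ 2) /
                          normMain cj Fd G C_U ε x m q

/-! ### The terms `n = p₀ − h_i q` belong to the class sum -/

/-- For `p₀ ∈ 𝓡_m` with `h_i x < p₀`, `m ≥ 1`, `w ≤ z` and `P_w ∣ P_y`: the integer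
`n_i = p₀ − h_i q` (any `q` with `q ≤ x`) lies in the W-tricked range
`{n ≤ U/m : (n(mn−1), P_w) = 1}` and in the class `p₀ (mod q)`. [cite: Maynard2016LargeGaps, Lemma 7 (proof, sentence after (6.21))] -/
theorem sub_hTuple_mul_mem {k : ℕ} {C_U ε : ℝ} {x m q p₀ : ℕ} (hm : 1 ≤ m)
    (hqx : (q : ℝ) ≤ x) (hp₀ : p₀ ∈ Rm C_U ε x m) (hwz : wFun x ≤ z x)
    (hPy : Pw x ∣ primorial ⌊y ε x⌋₊) (i : Fin k) (hi : (hTuple k x i : ℝ) * x < p₀) :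
    p₀ - hTuple k x i * q ∈ (baseSet C_U ε x m).filter (fun n => n % q = p₀ % q) := by
  simp only [Rm, sievedPrimes, Finset.mem_filter, Finset.mem_Icc] at hp₀
  obtain ⟨⟨-, hp₀U⟩, hp₀P, hp₀z, hp₀cop⟩ := hp₀
  set hq_ := hTuple k x i * q with hhq
  -- `h_i q < p₀`
  have hlt : hq_ < p₀ := by
    have h1 : (hTuple k x i : ℝ) * q ≤ (hTuple k x i : ℝ) * x :=
      mul_le_mul_of_nonneg_left hqx (Nat.cast_nonneg _)
    have h2 : ((hTuple k x i * q : ℕ) : ℝ) < p₀ := by push_cast; linarith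
    exact_mod_cast h2
  set n := p₀ - hq_ with hn
  have hpn : p₀ = n + hq_ := (Nat.sub_add_cancel hlt.le).symm
  have hn1 : 1 ≤ n := by omega
  -- `P_w ∣ h_i q`
  obtain ⟨t, ht⟩ : Pw x ∣ hq_ := (Pw_dvd_hTuple k x i).mul_right q
  -- coprimality of `p₀` and `m p₀ − 1` with `P_w`
  have hcop₀ : Nat.Coprime p₀ (Pw x) := coprime_Pw_of_prime_gt_z hp₀P hp₀z hwz
  have hcop₁ : Nat.Coprime (m * p₀ - 1) (Pw x) := hp₀cop.coprime_dvd_right hPy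
  refine Finset.mem_filter.2 ⟨?_, ?_⟩
  · unfold baseSet
    refine Finset.mem_filter.2 ⟨Finset.mem_Icc.2 ⟨hn1, le_trans (Nat.sub_le _ _) hp₀U⟩, ?_⟩
    refine Nat.Coprime.mul_left ?_ ?_
    · -- `(n, P_w) = (p₀, P_w) = 1`
      have h1 : Nat.Coprime (n + t * Pw x) (Pw x) := by
        rw [mul_comm t, ← ht, ← hpn]; exact hcop₀
      exact (Nat.coprime_add_mul_right_left n (Pw x) t).1 h1
    · -- `(m n − 1, P_w) = (m p₀ − 1, P_w) = 1`
      have hmn : 1 ≤ m * n := Nat.one_le_iff_ne_zero.2 (Nat.mul_ne_zero (by omega) (by omega))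
      have h2 : m * p₀ - 1 = (m * n - 1) + (m * t) * Pw x := by
        rw [hpn, Nat.mul_add, ht, Nat.sub_add_comm hmn, mul_comm (Pw x) t, Nat.mul_assoc]
      have h1 : Nat.Coprime ((m * n - 1) + (m * t) * Pw x) (Pw x) := by rw [← h2]; exact hcop₁
      exact (Nat.coprime_add_mul_right_left (m * n - 1) (Pw x) (m * t)).1 h1
  · -- `n ≡ p₀ (mod q)`
    show (p₀ - hTuple k x i * q) % q = p₀ % q
    rw [mul_comm]
    exact Nat.sub_mul_mod (by rw [mul_comm]; exact hlt.le)

/-- **(6.22)**: `Σ_i (divisor sum at p₀ − h_i q)² ≤ classSum(p₀ mod q)` — the dropped terms are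
non-negative and the `n_i = p₀ − h_i q` are distinct members of the class.
[cite: Maynard2016LargeGaps, Lemma 7 (proof, display (6.22))] -/
theorem sum_divSum_sq_le_classSum {k J : ℕ} (cj : Fin J → ℝ) (Fd : Fin k → Fin J → ℝ → ℝ)
    (G : ℝ → ℝ) {C_U ε : ℝ} {x m q p₀ : ℕ} (hm : 1 ≤ m) (hq : 1 ≤ q) (hqx : (q : ℝ) ≤ x)
    (hp₀ : p₀ ∈ Rm C_U ε x m) (hwz : wFun x ≤ z x) (hPy : Pw x ∣ primorial ⌊y ε x⌋₊)
    (hi : ∀ i : Fin k, (hTuple k x i : ℝ) * x < p₀) :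
    ∑ i : Fin k, divSum cj Fd G ε x m q (p₀ - hTuple k x i * q) ^ 2 ≤
      classSum cj Fd G C_U ε x m q (p₀ % q) := by
  -- the map `i ↦ p₀ − h_i q` is injective
  have hlt : ∀ i : Fin k, hTuple k x i * q ≤ p₀ := by
    intro i
    have h1 : (hTuple k x i : ℝ) * q ≤ (hTuple k x i : ℝ) * x :=
      mul_le_mul_of_nonneg_left hqx (Nat.cast_nonneg _)
    have h2 : ((hTuple k x i * q : ℕ) : ℝ) < p₀ := by push_cast; linarith [hi i]
    exact_mod_cast h2.le
  have hinj : Function.Injective fun i : Fin k => p₀ - hTuple k x i * q := by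
    intro i j hij
    have h1 : hTuple k x i * q = hTuple k x j * q := by
      have := congrArg (fun t => p₀ - t) hij
      simp only [Nat.sub_sub_self (hlt i), Nat.sub_sub_self (hlt j)] at this
      exact this
    exact hTuple_injective k x (Nat.eq_of_mul_eq_mul_right (by omega) h1)
  unfold classSum
  rw [← Finset.sum_image (f := fun n => divSum cj Fd G ε x m q n ^ 2)
    (fun i _ j _ h => hinj h)]
  refine Finset.sum_le_sum_of_subset_of_nonneg ?_ (fun _ _ _ => sq_nonneg _)
  intro n hn
  obtain ⟨i, -, rfl⟩ := Finset.mem_image.1 hn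
  exact sub_hTuple_mul_mem hm hqx hp₀ hwz hPy i (hi i)

/-! ### `Lemma7Main` from `Lemma7Pos` -/

/-- **`Lemma7Pos → Lemma7Main`** (display (6.22): positivity, PROVED).
[cite: Maynard2016LargeGaps, Lemma 7 (proof, display (6.22))] -/
theorem lemma7Main_of_pos (h : Lemma7Pos) : Lemma7Main := by
  intro C_U hCU
  have hεhalf : ∀ᶠ ε : ℝ in 𝓝[>] 0, ε ≤ 1 / 2 :=
    eventually_nhdsWithin_of_eventually_nhds (eventually_le_nhds (by norm_num : (0 : ℝ) < 1 / 2))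
  filter_upwards [h C_U hCU, hεhalf] with ε hε hεh
  obtain ⟨c, hc, hPc⟩ := hε
  refine ⟨c, hc, ?_⟩
  intro k hk J cj Fd G hD hI1 hI2 δ hδ κ hκ
  filter_upwards [hPc k hk J cj Fd G hD hI1 hI2 δ hδ κ hκ, eventually_wTrick hεh,
    eventually_iteratedLogs, eventually_gt_atTop 0] with x hPx hW hLogs hx0
  intro m hm1 hme hmU A B hA hB hAB p₀ hp₀ hp₀'
  obtain ⟨hL₃, hly, -, hwz, hPy, -⟩ := hW
  obtain ⟨hL, hL₂, -, -, -, -, -⟩ := hLogs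
  have hB0 : 0 ≤ B := by
    have : 0 ≤ δ * (Rm C_U ε x m).card * Real.log x := by
      have : 0 ≤ Real.log x := by linarith
      positivity
    have hx0' : (0 : ℝ) ≤ x := by positivity
    linarith
  have hU : 0 ≤ U C_U ε x := (U_pos hCU hx0 hly (by linarith)).le
  have hM : ∀ q, 0 ≤ normMain cj Fd G C_U ε x m q := fun q =>
    normMain_nonneg hU hI1.le hI2.le (by linarith) hly.le
  refine (hPx m hm1 hme hmU A B hA hB hAB p₀ hp₀ hp₀').trans (Finset.sum_le_sum fun q hq => ?_)
  obtain ⟨hqP, -, hqB⟩ := (mem_intervalPrimes hB0).1 hq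
  exact div_le_div_of_nonneg_right (sum_divSum_sq_le_classSum cj Fd G hm1 hqP.one_le
    (hqB.trans hB) hp₀ hwz hPy fun i => (hp₀' i).1) (hM q)

/-! ### Consequences -/

/-- Lemma 7 from Lemma 6 and `Lemma7Pos`. [cite: Maynard2016LargeGaps, Lemma 7] -/
theorem lemma7_of_lemma6_pos (h6 : Lemma6) (h7 : Lemma7Pos) : Lemma7 :=
  lemma7_of_lemma6_main h6 (lemma7Main_of_pos h7)

/-- **Maynard's Theorem 1 from Lemma 6 and `Lemma7Pos`.** [cite: Maynard2016LargeGaps, Theorem 1] -/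
theorem theorem1_of_lemma6_pos (h6 : Lemma6) (h7 : Lemma7Pos) :
    Literature.NumberTheory.Sieve.Maynard2016_theorem1 :=
  theorem1_of_lemma6_main h6 (lemma7Main_of_pos h7)

/-- **`∀ c, RankinConstant c` from Lemma 6 and `Lemma7Pos`.** [cite: Maynard2016LargeGaps, Theorem 1] -/
theorem forall_rankinConstant_of_lemma6_pos (h6 : Lemma6) (h7 : Lemma7Pos) (c : ℝ) :
    Literature.NumberTheory.Sieve.RankinConstant c :=
  forall_rankinConstant_of_lemma6_main h6 (lemma7Main_of_pos h7) c

end Maynard2016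

end Literature.NumberTheory.Sieve
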